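import Mathlib.Algebra.Field.ZMod
import Mathlib.Algebra.QuadraticAlgebra.Basic
import Summits.MatrixMultiplication.OmegaCensus.GoldenCyclic
import Summits.MatrixMultiplication.OmegaCensus.BoxUsefulDihedral

/-!
# ω-census, family (b3): the golden groups — ONE ROOT SUFFICES (`𝔽_p[ζ₅] ⋊ C₅` for `τ` embeds the group for `−1 − τ`)

HONEST FRAMING (pub-omega census; verbatim): lottery ticket; floor = certified bounds/negative ranges.
Census BOOKKEEPING (conjecture C9 of the cell; pub-omega stpp-1 gen 22).  The two roots of `τ² + τ = 1` in `𝔽_p` are `τ` and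
`τ' = −1 − τ` (`root_cases`); `ζ²` is a root of `x² − τ'x + 1` in `𝔽_p[ζ] = Gold p τ` (`ζ² + ζ⁻² = τ² − 2 = τ'`), so
`QuadraticAlgebra.lift` gives the algebra map `Gold p τ' → Gold p τ`, `ζ' ↦ ζ²` (`conjHom`, injective since `τ ≠ 0`), and
`(i, t) ↦ (conjHom i, 2t)` is an injective group homomorphism `GoldCyc p τ' →* GoldCyc p τ` (`flipHom`).  Hence
(`not_boxUseful_of_injective'`): **if `GoldCyc p τ₀` is not box-useful for ONE root `τ₀`, then `GoldCyc p τ` is not box-useful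
for every root `τ`** (`GoldCyc.not_boxUseful_of_root`) — the per-prime certificates below the uniform bound are needed for one
root per prime only.  Nothing here is progress on `ω`.
-/

namespace Summit.MatrixMultiplication.OmegaCensus

namespace Gold

variable {p : ℕ} {τ : ZMod p}

/-- The conjugate root: `τ' = −1 − τ` also satisfies `τ'² + τ' = 1`. [folklore] -/
theorem conj_root (hτ : τ ^ 2 + τ = 1) : (-1 - τ) ^ 2 + (-1 - τ) = 1 := by linear_combination hτ

/-- `Fact` form of `conj_root` (group law of `GoldCyc p (−1 − τ)`). [folklore] -/
instance fact_conj_root [hτ : Fact (τ ^ 2 + τ = 1)] : Fact ((-1 - τ) ^ 2 + (-1 - τ) = 1) := ⟨conj_root hτ.out⟩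

/-- The two roots of `x² + x = 1` modulo a prime are `τ` and `−1 − τ`. [folklore] -/
theorem root_cases [Fact p.Prime] (hτ : τ ^ 2 + τ = 1) {σ : ZMod p} (hσ : σ ^ 2 + σ = 1) : σ = τ ∨ σ = -1 - τ := by
  have h : (σ - τ) * (σ - (-1 - τ)) = 0 := by linear_combination hσ - hτ
  rcases mul_eq_zero.1 h with h | h
  · exact Or.inl (sub_eq_zero.1 h)
  · exact Or.inr (sub_eq_zero.1 h)

/-- `ζ²` is a root of `x² = −1 + τ'x`, `τ' = −1 − τ`, in `𝔽_p[ζ]` (using `τ² + τ = 1`). [folklore] -/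
theorem gz_sq_root (hτ : τ ^ 2 + τ = 1) :
    (gz : Gold p τ) ^ 2 * gz ^ 2 = (-1 : ZMod p) • (1 : Gold p τ) + (-1 - τ) • gz ^ 2 := by
  rw [← pow_add, show 2 + 2 = 4 by rfl, gz_pow_four hτ, gz_pow_two]
  ext
  · simp [QuadraticAlgebra.re_one]
  · simp [QuadraticAlgebra.im_one]
    linear_combination hτ

/-- The algebra map `Gold p (−1 − τ) → Gold p τ`, `ζ' ↦ ζ²`. [folklore] -/
def conjHom (hτ : τ ^ 2 + τ = 1) : Gold p (-1 - τ) →ₐ[ZMod p] Gold p τ :=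
  QuadraticAlgebra.lift ⟨gz ^ 2, gz_sq_root hτ⟩

/-- `conjHom` in coordinates: `A + Bζ' ↦ (A − B) + Bτ ζ`. [folklore] -/
theorem conjHom_apply (hτ : τ ^ 2 + τ = 1) (z : Gold p (-1 - τ)) :
    conjHom hτ z = (⟨z.re - z.im, z.im * τ⟩ : Gold p τ) := by
  simp only [conjHom, QuadraticAlgebra.lift_apply_apply]
  rw [gz_pow_two]
  ext
  · simp [QuadraticAlgebra.re_one, sub_eq_add_neg]
  · simp [QuadraticAlgebra.im_one]

/-- `conjHom ζ' = ζ²`. [folklore] -/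
theorem conjHom_gz (hτ : τ ^ 2 + τ = 1) : conjHom hτ (gz : Gold p (-1 - τ)) = (gz : Gold p τ) ^ 2 := by
  rw [conjHom, QuadraticAlgebra.lift_apply_apply]
  simp [gz]

/-- `conjHom` is injective (`τ ≠ 0`). [folklore] -/
theorem conjHom_injective [Fact p.Prime] (hτ : τ ^ 2 + τ = 1) : Function.Injective (conjHom (p := p) hτ) := by
  have hτ0 : τ ≠ 0 := by
    intro h; rw [h] at hτ; simp at hτ
  intro z w h
  rw [conjHom_apply, conjHom_apply, QuadraticAlgebra.mk.injEq] at h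
  obtain ⟨h1, h2⟩ := h
  have him : z.im = w.im := mul_right_cancel₀ hτ0 h2
  ext
  · rw [him] at h1; exact sub_left_inj.1 h1
  · exact him

/-- `conjHom` on the `ℤ/5`-action: `conjHom (ζ'^t · j) = ζ^{2t} · conjHom j`. [folklore] -/
theorem conjHom_act (hτ : τ ^ 2 + τ = 1) (t : ZMod 5) (j : Gold p (-1 - τ)) :
    conjHom hτ (RCyc.act gz t * j) = RCyc.act (gz : Gold p τ) (2 * t) * conjHom hτ j := by
  rw [show (2 : ZMod 5) * t = t + t by ring, RCyc.act_add (gz_pow_five hτ), map_mul]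
  simp only [RCyc.act, map_pow, conjHom_gz, ← pow_mul, ← pow_add, two_mul]

end Gold

namespace GoldCyc

open Gold

variable {p : ℕ} {τ : ZMod p}

/-- **The embedding `GoldCyc p (−1 − τ) ↪ GoldCyc p τ`**, `(i, t) ↦ (conjHom i, 2t)`. [folklore] -/
def flipHom [hτ : Fact (τ ^ 2 + τ = 1)] : GoldCyc p (-1 - τ) →* GoldCyc p τ where
  toFun x := ⟨conjHom hτ.out x.i, 2 * x.t⟩
  map_one' := by
    simp only [RCyc.one_def, map_zero, mul_zero]
  map_mul' x y := by
    apply RCyc.ext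
    · simp only [RCyc.mul_def, map_add, conjHom_act hτ.out]
    · simp only [RCyc.mul_def, mul_add]

/-- `flipHom` is injective. [folklore] -/
theorem flipHom_injective [Fact p.Prime] [hτ : Fact (τ ^ 2 + τ = 1)] :
    Function.Injective (flipHom (p := p) (τ := τ)) := by
  intro x y h
  have hi := congrArg RCyc.i h
  have ht := congrArg RCyc.t h
  simp only [flipHom, MonoidHom.coe_mk, OneHom.coe_mk] at hi ht
  refine RCyc.ext (conjHom_injective hτ.out hi) ?_
  have := congrArg (fun z : ZMod 5 => 3 * z) ht
  simp only [← mul_assoc] at this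
  rw [show (3 : ZMod 5) * 2 = 1 by rfl, one_mul, one_mul] at this
  exact this

/-- **One root suffices.** If `GoldCyc p τ₀` is not box-useful for one root `τ₀` of `x² + x = 1` (`p` prime), then
`GoldCyc p τ` is not box-useful for every root `τ` (`τ = τ₀`, or `τ = −1 − τ₀` and `flipHom` embeds the `τ₀`-group).
[folklore] -/
theorem not_boxUseful_of_root [Fact p.Prime] [NeZero p] {τ₀ : ZMod p} [Fact (τ₀ ^ 2 + τ₀ = 1)]
    (T : ¬ BoxUseful (GoldCyc p τ₀)) (τ : ZMod p) [hτ : Fact (τ ^ 2 + τ = 1)] : ¬ BoxUseful (GoldCyc p τ) := by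
  rcases root_cases hτ.out (Fact.out : τ₀ ^ 2 + τ₀ = 1) with h | h
  · subst h; exact T
  · subst h
    exact not_boxUseful_of_injective' flipHom flipHom_injective T

end GoldCyc

end Summit.MatrixMultiplication.OmegaCensus
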